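import Mathlib
import Literature.NumberTheory.Transcendental.KZCubeRationalMoves
import Literature.NumberTheory.Transcendental.KZSemialgebraicComplex
import Literature.NumberTheory.Transcendental.SemialgebraicMapsProofs

/-!
# `TateFamilyKernel` — the Tate anchor: the fibre at `ϖ₀` is one Stokes move away from the scaled box

Crux `TateFamilyKernel` (stmt-KontsevichZagierPeriods-9130, route `InverseLandau`). For a rational
family `F = P/Q` in the cube variables `z ∈ [0,1]ⁿ` and the parameter `ϖ`, with `Q(z, ϖ₀ s) ≠ 0` on the
closed box `[0,1]ⁿ × [0,1]` (`ϖ₀` real algebraic), the TATE HOMOTOPY `G(z, s) = s · F(z, ϖ₀ s)` is a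
regular, `ℚ`-semialgebraic primitive along `s` on `[0,1]ⁿ⁺¹` with `G(z, 1) = F(z, ϖ₀)` and `G(z, 0) = 0`.
One cubical Stokes move (`KZ.cubicalStokesGens`, rule (3)) therefore gives

  `[[0,1]ⁿ⁺¹, ∂ₛG] − [[0,1]ⁿ, F(·, ϖ₀)] ∈ KZ.relations`,   `∂ₛG(z,s) = (F + ϖ ∂_ϖF)(z, ϖ₀ s)`,

so the crux's fibre is a relation iff the scaled box of the family `∂_ϖ(ϖF) = (PQ + ϖ(P_ϖQ − PQ_ϖ))/Q²`
— again a Tate family with identically vanishing fibre integrals — is one. No hypothesis on the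
integrals is used here; this is pure calculus of moves.
-/

noncomputable section

open MeasureTheory Set MvPolynomial
open Literature.NumberTheory.Transcendental
open Literature.ModelTheory.ExponentialFields (IsSemialgebraic analyticOnNhd_aeval
  isSemialgebraic_setOf_eval_ne_zero)

namespace Summit.KontsevichZagierPeriods.InverseLandau.TateFamilyKernel

variable {n : ℕ}

/-! ### The scaling map `(z, s) ↦ (z, ϖ₀ s)` and the slice map `z ↦ (z, ϖ₀)` -/

/-- The scaling of the last coordinate `(z, s) ↦ (z, ϖ₀ s)` is (the coercion of) a continuous
linear map. [folklore] -/
theorem exists_clm_eq_scale (n : ℕ) (ϖ₀ : ℝ) :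
    ∃ L : (Fin (n + 1) → ℝ) →L[ℝ] (Fin (n + 1) → ℝ),
      ∀ w, L w = Fin.snoc (Fin.init w) (ϖ₀ * w (Fin.last n)) := by
  refine ⟨ContinuousLinearMap.pi fun j =>
    Fin.lastCases (ϖ₀ • ContinuousLinearMap.proj (Fin.last n))
      (fun i => ContinuousLinearMap.proj (Fin.castSucc i)) j, fun w => ?_⟩
  ext j
  refine Fin.lastCases ?_ (fun i => ?_) j
  · simp
  · simp [Fin.init]

/-- The scaling map `(z, s) ↦ (z, ϖ₀ s)` is `ℚ`-semialgebraic on any `ℚ`-semialgebraic set when `ϖ₀`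
is real algebraic. [cite: BochnakCosteRoy1998, §2.2] -/
theorem isSemialgebraicMapOn_scale {s : Set (Fin (n + 1) → ℝ)} (hs : IsSemialgebraic ℚ s)
    {ϖ₀ : ℝ} (hϖ₀ : IsAlgebraic ℚ ϖ₀) :
    IsSemialgebraicMapOn ℚ s
      (fun w : Fin (n + 1) → ℝ => (Fin.snoc (Fin.init w) (ϖ₀ * w (Fin.last n)) : Fin (n + 1) → ℝ)) := by
  refine IsSemialgebraicMapOn.of_forall hs fun j => ?_
  refine Fin.lastCases ?_ (fun i => ?_) j
  · have h := IsSemialgebraicFunOn.mul_holds (isSemialgebraicFunOn_const_of_isAlgebraic hs hϖ₀)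
      (isSemialgebraicFunOn_apply hs (Fin.last n))
    refine h.congr fun w _ => ?_
    simp
  · refine (isSemialgebraicFunOn_apply hs (Fin.castSucc i)).congr fun w _ => ?_
    simp [Fin.init]

/-- The slice map `z ↦ (z, ϖ₀)` is `ℚ`-semialgebraic when `ϖ₀` is real algebraic.
[cite: BochnakCosteRoy1998, §2.2] -/
theorem isSemialgebraicMapOn_snoc_const {s : Set (Fin n → ℝ)} (hs : IsSemialgebraic ℚ s)
    {ϖ₀ : ℝ} (hϖ₀ : IsAlgebraic ℚ ϖ₀) :
    IsSemialgebraicMapOn ℚ s (fun z => (Fin.snoc z ϖ₀ : Fin (n + 1) → ℝ)) := by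
  refine IsSemialgebraicMapOn.of_forall hs fun j => ?_
  refine Fin.lastCases ?_ (fun i => ?_) j
  · simpa using isSemialgebraicFunOn_const_of_isAlgebraic hs hϖ₀
  · simpa using isSemialgebraicFunOn_apply hs i

/-! ### Regular rational functions precomposed with the two maps -/

/-- A ratio of `ℚ`-polynomials precomposed with a `ℚ`-semialgebraic map is `ℚ`-semialgebraic wherever
the denominator does not vanish. [cite: BochnakCosteRoy1998, Prop. 2.2.6] -/
theorem isSemialgebraicFunOn_aeval_div_aeval_comp {m : ℕ} {s : Set (Fin m → ℝ)}
    {φ : (Fin m → ℝ) → (Fin (n + 1) → ℝ)} (hφ : IsSemialgebraicMapOn ℚ s φ)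
    (P Q : MvPolynomial (Fin (n + 1)) ℚ) (hQ : ∀ x ∈ s, aeval (φ x) Q ≠ 0) :
    IsSemialgebraicFunOn ℚ s (fun x => aeval (φ x) P / aeval (φ x) Q) := by
  have ht : IsSemialgebraic ℚ {w : Fin (n + 1) → ℝ | aeval w Q ≠ 0} :=
    isSemialgebraic_setOf_eval_ne_zero Q
  have hg : IsSemialgebraicFunOn ℚ {w : Fin (n + 1) → ℝ | aeval w Q ≠ 0}
      (fun w => aeval w P / aeval w Q) :=
    isSemialgebraicFunOn_aeval_div_aeval ht P Q fun w hw => hw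
  exact IsSemialgebraicFunOn.comp_isSemialgebraicMapOn_holds hg hφ fun x hx => hQ x hx

/-- A ratio of `ℚ`-polynomials precomposed with a continuous linear map is analytic wherever the
denominator does not vanish. [folklore] -/
theorem analyticAt_aeval_div_aeval_comp_clm {m : ℕ} (L : (Fin m → ℝ) →L[ℝ] (Fin (n + 1) → ℝ))
    (P Q : MvPolynomial (Fin (n + 1)) ℚ) {x : Fin m → ℝ} (hQ : aeval (L x) Q ≠ 0) :
    AnalyticAt ℝ (fun x => aeval (L x) P / aeval (L x) Q) x := by
  have hP : AnalyticAt ℝ (fun x => aeval (L x) P) x :=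
    ((analyticOnNhd_aeval P) (L x) (mem_univ _)).comp (L.analyticAt x)
  have hQ' : AnalyticAt ℝ (fun x => aeval (L x) Q) x :=
    ((analyticOnNhd_aeval Q) (L x) (mem_univ _)).comp (L.analyticAt x)
  exact hP.div hQ' hQ

/-- The slice map `z ↦ (z, ϖ₀)` as an affine map: `z ↦ E z + (0, …, 0, ϖ₀)` with `E` the
embedding `z ↦ (z, 0)`. [folklore] -/
theorem snoc_eq_clm_add (ϖ₀ : ℝ) (z : Fin n → ℝ) :
    (Fin.snoc z ϖ₀ : Fin (n + 1) → ℝ) =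
      (ContinuousLinearMap.pi fun j => Fin.lastCases (0 : (Fin n → ℝ) →L[ℝ] ℝ)
        (fun i => ContinuousLinearMap.proj i) j) z + Fin.snoc (0 : Fin n → ℝ) ϖ₀ := by
  ext j
  refine Fin.lastCases ?_ (fun i => ?_) j
  · simp
  · simp

/-- A ratio of `ℚ`-polynomials sliced at `ϖ₀` is analytic wherever the denominator does not vanish.
[folklore] -/
theorem analyticAt_aeval_div_aeval_snoc (ϖ₀ : ℝ) (P Q : MvPolynomial (Fin (n + 1)) ℚ)
    {z : Fin n → ℝ} (hQ : aeval (Fin.snoc z ϖ₀ : Fin (n + 1) → ℝ) Q ≠ 0) :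
    AnalyticAt ℝ (fun z : Fin n → ℝ =>
      aeval (Fin.snoc z ϖ₀ : Fin (n + 1) → ℝ) P / aeval (Fin.snoc z ϖ₀ : Fin (n + 1) → ℝ) Q) z := by
  set E : (Fin n → ℝ) →L[ℝ] (Fin (n + 1) → ℝ) := ContinuousLinearMap.pi fun j =>
    Fin.lastCases (0 : (Fin n → ℝ) →L[ℝ] ℝ) (fun i => ContinuousLinearMap.proj i) j with hE
  have hι : AnalyticAt ℝ (fun z : Fin n → ℝ => (Fin.snoc z ϖ₀ : Fin (n + 1) → ℝ)) z := by
    have : (fun z : Fin n → ℝ => (Fin.snoc z ϖ₀ : Fin (n + 1) → ℝ)) =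
        fun z => E z + Fin.snoc (0 : Fin n → ℝ) ϖ₀ := funext fun z => snoc_eq_clm_add ϖ₀ z
    rw [this]
    exact (E.analyticAt z).add analyticAt_const
  have hP : AnalyticAt ℝ (fun z : Fin n → ℝ => aeval (Fin.snoc z ϖ₀ : Fin (n + 1) → ℝ) P) z :=
    ((analyticOnNhd_aeval P) _ (mem_univ _)).comp hι
  have hQ' : AnalyticAt ℝ (fun z : Fin n → ℝ => aeval (Fin.snoc z ϖ₀ : Fin (n + 1) → ℝ) Q) z :=
    ((analyticOnNhd_aeval Q) _ (mem_univ _)).comp hι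
  exact hP.div hQ' hQ

/-! ### The Tate anchor -/

/-- **Derivative of the Tate homotopy.** For fixed `z` with `Q(z, ϖ₀ t) ≠ 0`:
`d/ds [s · F(z, ϖ₀ s)]|_{s=t} = ((PQ + ϖ(∂_ϖP·Q − P·∂_ϖQ)) / Q²)(z, ϖ₀ t)` — the value at
`(z, ϖ₀ t)` of `∂_ϖ(ϖ F)`. [folklore] -/
theorem hasDerivAt_tateHomotopy (P Q : MvPolynomial (Fin (n + 1)) ℚ) (ϖ₀ : ℝ) (z : Fin n → ℝ)
    (t : ℝ) (hQ : aeval (Fin.snoc z (ϖ₀ * t) : Fin (n + 1) → ℝ) Q ≠ 0) :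
    HasDerivAt (fun s : ℝ => s * (aeval (Fin.snoc z (ϖ₀ * s) : Fin (n + 1) → ℝ) P /
        aeval (Fin.snoc z (ϖ₀ * s) : Fin (n + 1) → ℝ) Q))
      (aeval (Fin.snoc z (ϖ₀ * t) : Fin (n + 1) → ℝ)
          (P * Q + X (Fin.last n) * (pderiv (Fin.last n) P * Q - P * pderiv (Fin.last n) Q)) /
        aeval (Fin.snoc z (ϖ₀ * t) : Fin (n + 1) → ℝ) (Q ^ 2)) t := by
  -- the path `s ↦ (z, ϖ₀ s)` and its coordinate derivatives
  set γ : ℝ → (Fin (n + 1) → ℝ) := fun s => Fin.snoc z (ϖ₀ * s) with hγ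
  set γ' : Fin (n + 1) → ℝ := Fin.snoc (0 : Fin n → ℝ) ϖ₀ with hγ'
  have hγd : ∀ i, HasDerivAt (fun u => γ u i) (γ' i) t := by
    intro i
    refine Fin.lastCases ?_ (fun j => ?_) i
    · simp only [hγ, hγ', Fin.snoc_last]
      simpa using (hasDerivAt_id t).const_mul ϖ₀
    · simp only [hγ, hγ', Fin.snoc_castSucc]
      simpa using hasDerivAt_const t (z j)
  have hsum : ∀ R : MvPolynomial (Fin (n + 1)) ℚ,
      (∑ i, aeval (γ t) (pderiv i R) * γ' i) = aeval (γ t) (pderiv (Fin.last n) R) * ϖ₀ := by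
    intro R
    rw [Fin.sum_univ_castSucc]
    simp [hγ']
  have hP := (KZ.hasDerivAt_aeval_comp_real hγd P).congr_deriv (hsum P)
  have hQd := (KZ.hasDerivAt_aeval_comp_real hγd Q).congr_deriv (hsum Q)
  have hF := hP.div hQd hQ
  have h := (hasDerivAt_id t).mul hF
  refine h.congr_deriv ?_
  simp only [id, Pi.div_apply, map_add, map_mul, map_sub, map_pow, aeval_X,
    Fin.snoc_last, hγ]
  field_simp

/-- **The Tate anchor** (one cubical Stokes move). Let `F = P/Q` with `Q(z, ϖ₀ s) ≠ 0` for
`(z, s) ∈ [0,1]ⁿ⁺¹`, `ϖ₀` real algebraic. Then for the tame cube representations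
`B = [[0,1]ⁿ⁺¹, ((PQ + ϖ(∂_ϖP·Q − P·∂_ϖQ))/Q²)(z, ϖ₀ s)]` (the scaled box of `∂_ϖ(ϖF)`) and
`Φ = [[0,1]ⁿ, F(·, ϖ₀)]` (the fibre), `[B] − [Φ] ∈ KZ.relations`: Newton–Leibniz along `s` with the
primitive `s · F(z, ϖ₀ s)`, whose faces are `F(·, ϖ₀)` at `s = 1` and `0` at `s = 0`.
[cite: KontsevichZagier2001, §1.2 rule (3)] [cite: Ayoub2014, Def. 10] -/
theorem tateAnchor (P Q : MvPolynomial (Fin (n + 1)) ℚ) {ϖ₀ : ℝ} (hϖ₀ : IsAlgebraic ℚ ϖ₀)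
    (hQ : ∀ z ∈ KZ.cube n, ∀ s ∈ Icc (0 : ℝ) 1, aeval (Fin.snoc z (ϖ₀ * s) : Fin (n + 1) → ℝ) Q ≠ 0)
    (B : KZ.IntegralRep (n + 1)) (hB : B.IsTameCube)
    (hBi : ∀ w ∈ KZ.cube (n + 1), B.integrand w =
      aeval (Fin.snoc (Fin.init w) (ϖ₀ * w (Fin.last n)) : Fin (n + 1) → ℝ)
        (P * Q + X (Fin.last n) * (pderiv (Fin.last n) P * Q - P * pderiv (Fin.last n) Q)) /
        aeval (Fin.snoc (Fin.init w) (ϖ₀ * w (Fin.last n)) : Fin (n + 1) → ℝ) (Q ^ 2))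
    (Φ : KZ.IntegralRep n) (hΦ : Φ.IsTameCube)
    (hΦi : ∀ z ∈ KZ.cube n, Φ.integrand z =
      aeval (Fin.snoc z ϖ₀ : Fin (n + 1) → ℝ) P / aeval (Fin.snoc z ϖ₀ : Fin (n + 1) → ℝ) Q) :
    KZ.of B - KZ.of Φ ∈ KZ.relations := by
  -- the scaling `(z, s) ↦ (z, ϖ₀ s)` and the primitive `G(w) = w_last · F(scale w)`
  obtain ⟨L, hL⟩ := exists_clm_eq_scale n ϖ₀
  set G : (Fin (n + 1) → ℝ) → ℝ := fun w => w (Fin.last n) * (aeval (L w) P / aeval (L w) Q) with hG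
  have hQ' : ∀ w ∈ KZ.cube (n + 1), aeval (L w) Q ≠ 0 := by
    intro w hw
    rw [hL]
    have hw' := hw
    rw [KZ.cube_succ_eq] at hw'
    exact hQ _ hw'.1 _ ⟨hw'.2.1, hw'.2.2⟩
  have hGa : AnalyticOnNhd ℝ G (KZ.cube (n + 1)) := fun w hw =>
    ((ContinuousLinearMap.proj (R := ℝ) (φ := fun _ : Fin (n + 1) => ℝ) (Fin.last n)).analyticAt w).mul
      (analyticAt_aeval_div_aeval_comp_clm L P Q (hQ' w hw))
  have hGs : IsSemialgebraicFunOn ℚ (KZ.cube (n + 1)) G := by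
    refine IsSemialgebraicFunOn.mul_holds (isSemialgebraicFunOn_apply KZ.isSemialgebraic_cube (Fin.last n))
      ((isSemialgebraicFunOn_aeval_div_aeval_comp
        (isSemialgebraicMapOn_scale KZ.isSemialgebraic_cube hϖ₀) P Q ?_).congr fun w _ => by rw [hL])
    intro w hw
    rw [← hL]
    exact hQ' w hw
  have hLsnoc : ∀ (x : Fin n → ℝ) (s : ℝ), L (Fin.snoc x s) = Fin.snoc x (ϖ₀ * s) := fun x s => by
    rw [hL, Fin.init_snoc, Fin.snoc_last]
  refine KZ.cubicalStokesGens_subset_relations (KZ.mem_cubicalStokesGens hB hΦ hGa hGs ?_ ?_)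
  · -- derivative along `s`
    intro x hx t ht
    have hxt : (Fin.snoc x t : Fin (n + 1) → ℝ) ∈ KZ.cube (n + 1) :=
      KZ.snoc_mem_cube_iff.2 ⟨hx, ht.1, ht.2⟩
    rw [hBi _ hxt]
    simp only [Fin.init_snoc, Fin.snoc_last]
    have hfun : (fun s : ℝ => G (Fin.snoc x s)) = fun s : ℝ => s *
        (aeval (Fin.snoc x (ϖ₀ * s) : Fin (n + 1) → ℝ) P / aeval (Fin.snoc x (ϖ₀ * s) : Fin (n + 1) → ℝ) Q) := by
      funext s
      simp only [hG, Fin.snoc_last, hLsnoc]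
    rw [hfun]
    exact hasDerivAt_tateHomotopy P Q ϖ₀ x t (hQ x hx t ht)
  · -- the two faces
    intro x hx
    rw [hΦi x hx]
    simp [hG, hLsnoc]

/-! ### The two tame representations exist, and the crux hypotheses feed the anchor -/

/-- **The tame fibre exists.** If `Q(z, ϖ₀) ≠ 0` on `[0,1]ⁿ` (`ϖ₀` real algebraic), the fibre
`z ↦ P(z,ϖ₀)/Q(z,ϖ₀)` is analytic near the closed cube and `ℚ`-semialgebraic on it, hence carries a
tame cube representation `[[0,1]ⁿ, F(·,ϖ₀)]`. [cite: KontsevichZagier2001, §1.1] -/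
theorem exists_isTameCube_fibre (P Q : MvPolynomial (Fin (n + 1)) ℚ) {ϖ₀ : ℝ}
    (hϖ₀ : IsAlgebraic ℚ ϖ₀) (hQ : ∀ z ∈ KZ.cube n, aeval (Fin.snoc z ϖ₀ : Fin (n + 1) → ℝ) Q ≠ 0) :
    ∃ Φ : KZ.IntegralRep n, Φ.IsTameCube ∧ Φ.integrand = fun z =>
      aeval (Fin.snoc z ϖ₀ : Fin (n + 1) → ℝ) P / aeval (Fin.snoc z ϖ₀ : Fin (n + 1) → ℝ) Q := by
  have ha : AnalyticOnNhd ℝ (fun z : Fin n → ℝ =>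
      aeval (Fin.snoc z ϖ₀ : Fin (n + 1) → ℝ) P / aeval (Fin.snoc z ϖ₀ : Fin (n + 1) → ℝ) Q)
      (KZ.cube n) := fun z hz => analyticAt_aeval_div_aeval_snoc ϖ₀ P Q (hQ z hz)
  have hs : IsSemialgebraicFunOn ℚ (KZ.cube n) (fun z : Fin n → ℝ =>
      aeval (Fin.snoc z ϖ₀ : Fin (n + 1) → ℝ) P / aeval (Fin.snoc z ϖ₀ : Fin (n + 1) → ℝ) Q) :=
    isSemialgebraicFunOn_aeval_div_aeval_comp
      (isSemialgebraicMapOn_snoc_const KZ.isSemialgebraic_cube hϖ₀) P Q hQ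
  exact ⟨KZ.IntegralRep.tameCube _ ha hs, KZ.IntegralRep.isTameCube_tameCube _ ha hs, rfl⟩

/-- **The tame scaled box exists.** If `Q(z, ϖ₀ s) ≠ 0` on `[0,1]ⁿ⁺¹` (`ϖ₀` real algebraic), the
scaled box integrand `(z, s) ↦ ((PQ + ϖ(∂_ϖP·Q − P·∂_ϖQ))/Q²)(z, ϖ₀ s)` is analytic near the closed
cube and `ℚ`-semialgebraic on it, hence carries a tame cube representation.
[cite: KontsevichZagier2001, §1.1] -/
theorem exists_isTameCube_box (P Q : MvPolynomial (Fin (n + 1)) ℚ) {ϖ₀ : ℝ} (hϖ₀ : IsAlgebraic ℚ ϖ₀)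
    (hQ : ∀ z ∈ KZ.cube n, ∀ s ∈ Icc (0 : ℝ) 1, aeval (Fin.snoc z (ϖ₀ * s) : Fin (n + 1) → ℝ) Q ≠ 0) :
    ∃ B : KZ.IntegralRep (n + 1), B.IsTameCube ∧ B.integrand = fun w =>
      aeval (Fin.snoc (Fin.init w) (ϖ₀ * w (Fin.last n)) : Fin (n + 1) → ℝ)
        (P * Q + X (Fin.last n) * (pderiv (Fin.last n) P * Q - P * pderiv (Fin.last n) Q)) /
        aeval (Fin.snoc (Fin.init w) (ϖ₀ * w (Fin.last n)) : Fin (n + 1) → ℝ) (Q ^ 2) := by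
  obtain ⟨L, hL⟩ := exists_clm_eq_scale n ϖ₀
  have hQ' : ∀ w ∈ KZ.cube (n + 1),
      aeval (Fin.snoc (Fin.init w) (ϖ₀ * w (Fin.last n)) : Fin (n + 1) → ℝ) (Q ^ 2) ≠ 0 := by
    intro w hw
    rw [KZ.cube_succ_eq] at hw
    rw [map_pow]
    exact pow_ne_zero 2 (hQ _ hw.1 _ ⟨hw.2.1, hw.2.2⟩)
  set N : MvPolynomial (Fin (n + 1)) ℚ :=
    P * Q + X (Fin.last n) * (pderiv (Fin.last n) P * Q - P * pderiv (Fin.last n) Q) with hN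
  have ha : AnalyticOnNhd ℝ (fun w : Fin (n + 1) → ℝ =>
      aeval (Fin.snoc (Fin.init w) (ϖ₀ * w (Fin.last n)) : Fin (n + 1) → ℝ) N /
        aeval (Fin.snoc (Fin.init w) (ϖ₀ * w (Fin.last n)) : Fin (n + 1) → ℝ) (Q ^ 2))
      (KZ.cube (n + 1)) := by
    intro w hw
    have h := analyticAt_aeval_div_aeval_comp_clm L N (Q ^ 2) (x := w) (by rw [hL]; exact hQ' w hw)
    refine h.congr (Filter.Eventually.of_forall fun v => ?_)
    simp only [hL]
  have hs : IsSemialgebraicFunOn ℚ (KZ.cube (n + 1)) (fun w : Fin (n + 1) → ℝ =>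
      aeval (Fin.snoc (Fin.init w) (ϖ₀ * w (Fin.last n)) : Fin (n + 1) → ℝ) N /
        aeval (Fin.snoc (Fin.init w) (ϖ₀ * w (Fin.last n)) : Fin (n + 1) → ℝ) (Q ^ 2)) :=
    isSemialgebraicFunOn_aeval_div_aeval_comp
      (isSemialgebraicMapOn_scale KZ.isSemialgebraic_cube hϖ₀) N (Q ^ 2) hQ'
  exact ⟨KZ.IntegralRep.tameCube _ ha hs, KZ.IntegralRep.isTameCube_tameCube _ ha hs, rfl⟩

/-- **The crux hypotheses give non-vanishing on the scaled closed box.** If `Q(z, 0) = c₀ ≠ 0` for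
all `z` (Tate) and `Q ≠ 0` on `[0,1]ⁿ × (0, ε)` (admissible), then for `ϖ₀ ∈ (0, ε)`:
`Q(z, ϖ₀ s) ≠ 0` for `z ∈ [0,1]ⁿ`, `s ∈ [0,1]`. [folklore] -/
theorem aeval_scale_ne_zero {Q : MvPolynomial (Fin (n + 1)) ℚ} {ε ϖ₀ : ℝ}
    (hT : ∃ c₀ : ℚ, c₀ ≠ 0 ∧ ∀ z : Fin n → ℝ, aeval (Fin.snoc z (0 : ℝ) : Fin (n + 1) → ℝ) Q = (c₀ : ℝ))
    (hadm : ∀ (z : Fin n → ℝ) (ϖ : ℝ), (∀ i, z i ∈ Icc (0 : ℝ) 1) → ϖ ∈ Ioo 0 ε →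
      aeval (Fin.snoc z ϖ : Fin (n + 1) → ℝ) Q ≠ 0)
    (hϖ₀ : ϖ₀ ∈ Ioo 0 ε) :
    ∀ z ∈ KZ.cube n, ∀ s ∈ Icc (0 : ℝ) 1, aeval (Fin.snoc z (ϖ₀ * s) : Fin (n + 1) → ℝ) Q ≠ 0 := by
  intro z hz s hs
  rcases hs.1.eq_or_lt with h0 | hpos
  · obtain ⟨c₀, hc₀, hc⟩ := hT
    rw [← h0, mul_zero, hc z]
    exact_mod_cast hc₀
  · refine hadm z (ϖ₀ * s) (fun i => ⟨(KZ.mem_cube.1 hz i).1, (KZ.mem_cube.1 hz i).2⟩) ⟨?_, ?_⟩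
    · exact mul_pos hϖ₀.1 hpos
    · calc ϖ₀ * s ≤ ϖ₀ * 1 := by gcongr; exacts [hϖ₀.1.le, hs.2]
        _ = ϖ₀ := mul_one _
        _ < ε := hϖ₀.2

/-- **Box form of the crux's fibre claim** (anchored at the Tate point). Under the Tate and
admissibility hypotheses of `TateFamilyKernel` and for a real-algebraic `ϖ₀ ∈ (0, ε)`: if the tame
scaled box `[[0,1]ⁿ⁺¹, ∂_ϖ(ϖF)(z, ϖ₀ s)]` is a relation, then so is EVERY honest representation with
domain the closed cube `[0,1]ⁿ` whose integrand is the fibre `F(·, ϖ₀)` there — in particular every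
tame fibre. (Combine with `InverseLandauTateFamilyKernelOpenCube` for the open cube of the crux.)
[cite: KontsevichZagier2001, §1.2] -/
theorem of_fibre_mem_relations_of_box (P Q : MvPolynomial (Fin (n + 1)) ℚ) {ε ϖ₀ : ℝ}
    (hT : ∃ c₀ : ℚ, c₀ ≠ 0 ∧ ∀ z : Fin n → ℝ, aeval (Fin.snoc z (0 : ℝ) : Fin (n + 1) → ℝ) Q = (c₀ : ℝ))
    (hadm : ∀ (z : Fin n → ℝ) (ϖ : ℝ), (∀ i, z i ∈ Icc (0 : ℝ) 1) → ϖ ∈ Ioo 0 ε →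
      aeval (Fin.snoc z ϖ : Fin (n + 1) → ℝ) Q ≠ 0)
    (halg : IsAlgebraic ℚ ϖ₀) (hϖ₀ : ϖ₀ ∈ Ioo 0 ε)
    (hbox : ∀ B : KZ.IntegralRep (n + 1), B.IsTameCube → (∀ w ∈ KZ.cube (n + 1), B.integrand w =
      aeval (Fin.snoc (Fin.init w) (ϖ₀ * w (Fin.last n)) : Fin (n + 1) → ℝ)
        (P * Q + X (Fin.last n) * (pderiv (Fin.last n) P * Q - P * pderiv (Fin.last n) Q)) /
        aeval (Fin.snoc (Fin.init w) (ϖ₀ * w (Fin.last n)) : Fin (n + 1) → ℝ) (Q ^ 2)) →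
      KZ.of B ∈ KZ.relations)
    (Φ : KZ.IntegralRep n) (hΦd : Φ.domain = KZ.cube n)
    (hΦi : ∀ z ∈ KZ.cube n, Φ.integrand z =
      aeval (Fin.snoc z ϖ₀ : Fin (n + 1) → ℝ) P / aeval (Fin.snoc z ϖ₀ : Fin (n + 1) → ℝ) Q) :
    KZ.of Φ ∈ KZ.relations := by
  have hQ := aeval_scale_ne_zero hT hadm hϖ₀
  have hQ1 : ∀ z ∈ KZ.cube n, aeval (Fin.snoc z ϖ₀ : Fin (n + 1) → ℝ) Q ≠ 0 := fun z hz => by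
    simpa using hQ z hz 1 ⟨zero_le_one, le_rfl⟩
  obtain ⟨B, hB, hBi⟩ := exists_isTameCube_box P Q halg hQ
  obtain ⟨Φ₀, hΦ₀, hΦ₀i⟩ := exists_isTameCube_fibre P Q halg hQ1
  have h1 : KZ.of B - KZ.of Φ₀ ∈ KZ.relations :=
    tateAnchor P Q halg hQ B hB (fun w _ => by rw [hBi]) Φ₀ hΦ₀ (fun z _ => by rw [hΦ₀i])
  have h2 : KZ.of Φ₀ - KZ.of Φ ∈ KZ.relations :=
    KZ.of_sub_of_mem_relations_of_eqOn (by rw [hΦd, hΦ₀.domain_eq]) fun z hz => by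
      rw [hΦ₀.domain_eq] at hz
      rw [hΦ₀i, hΦi z hz]
  have h3 := hbox B hB fun w _ => by rw [hBi]
  have : KZ.of Φ = KZ.of B - (KZ.of B - KZ.of Φ₀) - (KZ.of Φ₀ - KZ.of Φ) := by abel
  rw [this]
  exact KZ.relations.sub_mem (KZ.relations.sub_mem h3 h1) h2

end Summit.KontsevichZagierPeriods.InverseLandau.TateFamilyKernel
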